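/-
Copyright (c) 2026 the pub-hodgecm-mathlib formalisation cell (harness21).  Prover seat hodgecm-mathlib-F0P2-p01 (g13), 2026-09-01.  Road «S3-tree», LIFT (ii) PIECE LEMMAS
(architect A-p16 (g30) A-88 (7) ∕ A-91 (3) ∕ A-96 (3)): the level-2 piece `g` restricted to the interior fixed cosets IS a level-1 piece `g′` of the Cayley shift.
-/
import Literature.NumberTheory.Automorphic.UnitaryLevelTwoInteriorRelabel   -- ★ p846407 (this seat): LIFT (ii) group side; ⊇ ★ (F2) p845770, ★ T4′-GEN p845888, ★ `CompletionCompositumUnitBall`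
import Literature.NumberTheory.Rogawski1990.LocalTransferFundamentalLemma   -- ★ `IsLocSmooth`
import HarnessLib

/-!
# LIFT (ii) piece lemmas: the interior level-one piece `g′` of a level-two piece `g` (road «S3-tree», `stub_liftOneTwo`; Kottwitz 1986 §3, Rogawski 1990 §4.9)

Topic `NumberTheory/Automorphic`; namespace `Literature.NumberTheory.Automorphic`.  THEOREMS ONLY (no definition, no instance, no notation, no named fact, no `sorry`).
Cell `pub/hodgecm-mathlib` (D-0151), crux H413 = `stmt-HodgeConjecture-24833`; road «S3-tree» (architect A-p16 (g30) A-88 (6)(7), A-91 (3), A-93 (1), A-96 (3); END F0P3a-p03 (g15)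
fold v1 «LIFT» `stub_liftOneTwo`; LIFT (ii) class organ F0P3a-p06 (g14); P-1 F0P3b-p01 (g12)).  Seat F0P2-p01 (g13).  HONEST LABEL: HC_CM is proved only modulo the 2 remaining
named inputs (hLiu418 24832, h413 24833) until rung 0 closes; nothing printed is asserted here.

THE SETTING (tokens of ★ `UnitaryLevelTwoInteriorRelabel`, A-69 (β)): `G = (cmDatum L N H).Local v` at a non-split `v`, `K = cmLocalIntegralLevel L N H v`,
`e = localNonsplitEquiv … w hw`, `ϖ ∈ L_w` with `0 < |ϖ| < 1`; «`x_w ≡ 1 (mod ϖ^j)`» is `IsIntMatrix ((ϖ ^ j)⁻¹ • (↑(e x) − 1))`; a LEVEL-`j` PIECE on `K` is a function `ψ : G → ℂ`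
with `IsLocSmooth ψ`, `tsupport ψ ⊆ K`, Ad(`K`)-invariance and left-invariance under «`≡ 1 (mod ϖ^j)`».  `γ u ∈ G` with `q(e u) = 1 + ϖ⁻¹(e γ − 1)` (`q ∈ 𝒪_w[T]`,
CAYLEY) and `r := 1 + ϖ·(q − 1)`.

THE MATHEMATICS.
* §1 plumbing: the level-1 set `{U | U_w ≡ 1 (mod ϖ)}` is OPEN in `G` and contained in `K`; a `K`-supported function left-invariant under it is `IsLocSmooth` with `tsupport ⊆ K`;
  two elements of `G` congruent `mod ϖ²` (the second in `K`) give the same value of a level-2-invariant `ψ`; element form of ★ `sep_fixedBy_interior_eq_fixedBy_of_mem_adjoin`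
  (`g⁻¹ug ∈ K ↔ g⁻¹γg ∈ K ∧ (g⁻¹γg)_w ≡ 1 (mod ϖ)`); `e(kxk⁻¹) = e k · e x · (e k)⁻¹`.
* §2 **THE INTERIOR PIECE `g′`** (`exists_levelOne_piece_interior`): for a level-2 piece `g` (only `hg2` and Ad-`K`-invariance are used) there is a LEVEL-1 PIECE `g′` with
  (a) `g′ x = g k₂` whenever `x, k₂ ∈ K` and `r(e x) ≡ e k₂ (mod ϖ²)` (so its Jordan values are `g(1), g(1 + ϖN_tv), g(1 + ϖN_reg)` at the END's representatives, A-91 (3)),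
  (b) `g′ (g₀⁻¹ u g₀) = g (g₀⁻¹ γ g₀)` for every fixed coset `g₀K` of `u` — `g′ = 1_K·(g ∘ relabel)` of A-88 (6)(ii), realised WITHOUT a relabelling map as
  `g′ x := g k₂` for any admissible `k₂` (`0` if none ∕ off `K`), well defined by `hg2` (★ LEVEL GAIN).  With ★ `sum_fixedBy_interior_eq_sum_fixedBy_cayley_relabel` the interior
  term of `γ`'s unfolded orbital integral is `Σᶠ_{q ∈ Fix_u} g′(q.out⁻¹ u q.out)`, i.e. `u`'s unfolded orbital integral of the level-1 piece `g′` (T3′ at `u`).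

## References
* [Kottwitz1986] R. E. Kottwitz, *Base change for unit elements of Hecke algebras*, Compositio Math. 60 (1986): §3.
* [Rogawski1990] J. Rogawski, Ann. of Math. Stud. 123 (1990): §4.9 Prop. 4.9.1 (a) p. 55; §1.6 p. 6 (`C_c^∞`).
* [BernsteinZelevinsky1976] I. N. Bernstein, A. V. Zelevinsky, Russian Math. Surveys 31 (1976): §1.1 (locally constant functions, congruence levels).
* [PlatonovRapinchuk1994] V. Platonov, A. Rapinchuk, *Algebraic Groups and Number Theory* (1994): §5.1.
-/

set_option autoImplicit false

noncomputable section

open scoped Valued WithZero Matrix MatrixGroups Polynomial Topology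
open Set NumberField IsDedekindDomain Polynomial

namespace Literature.NumberTheory.Automorphic

open UnitaryGroup Literature.NumberTheory.Automorphic.UnitaryLatticeTree Literature.NumberTheory.Automorphic.HermitianLattice
  Literature.NumberTheory.Rogawski1990

section Matrices

variable {K : Type*} [Field K] [Valued K ℤᵐ⁰] {N : ℕ}

/-- Negation preserves integrality. [cite: Kottwitz1986, §3] -/
theorem isIntMatrix_neg {A : Matrix (Fin N) (Fin N) K} (hA : IsIntMatrix A) : IsIntMatrix (-A) := fun i j => by
  rw [Matrix.neg_apply, Valuation.map_neg]; exact hA i j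

/-- **Admissibility is a congruence class**: `R ≡ M₁` and `R ≡ M₂ (mod d)` ⇒ `M₁ ≡ M₂ (mod d)`. [cite: Kottwitz1986, §3] -/
theorem isIntMatrix_inv_smul_sub_of_sub_of_sub {R M₁ M₂ : Matrix (Fin N) (Fin N) K} (d : K)
    (h₁ : IsIntMatrix (d⁻¹ • (R - M₁))) (h₂ : IsIntMatrix (d⁻¹ • (R - M₂))) : IsIntMatrix (d⁻¹ • (M₁ - M₂)) := by
  have e : d⁻¹ • (M₁ - M₂) = d⁻¹ • (R - M₂) - d⁻¹ • (R - M₁) := by rw [← smul_sub, sub_sub_sub_cancel_left]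
  rw [e]
  exact isIntMatrix_sub h₂ h₁

/-- **LEVEL GAIN, admissibility form**: `A ≡ A′ (mod ϖ)` (both integral) and `r(A) ≡ M (mod ϖ²)` ⇒ `r(A′) ≡ M (mod ϖ²)`, `r = 1 + ϖ·(q − 1)`
(★ `isIntMatrix_inv_pow_succ_smul_aeval_relabel_sub`). [cite: Kottwitz1986, §3] [cite: Rogawski1990, §4.9 Prop. 4.9.1 (a) p. 55] -/
theorem isIntMatrix_relabel_sub_of_congr {A A' M : Matrix (Fin N) (Fin N) K} (hA : IsIntMatrix A) (hA' : IsIntMatrix A') {ϖ : 𝒪[K]} (hϖ0 : (ϖ : K) ≠ 0)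
    (hAA' : IsIntMatrix (((ϖ : K) ^ 1)⁻¹ • (A - A'))) (q : 𝒪[K][X])
    (h : IsIntMatrix (((ϖ : K) ^ 2)⁻¹ • (aeval A (1 + C ϖ * (q - 1)) - M))) : IsIntMatrix (((ϖ : K) ^ 2)⁻¹ • (aeval A' (1 + C ϖ * (q - 1)) - M)) := by
  have h1 := isIntMatrix_inv_pow_succ_smul_aeval_relabel_sub hA' hA hϖ0 1 (by rw [← neg_sub, smul_neg]; exact isIntMatrix_neg hAA') q
  rw [show (1 : ℕ) + 1 = 2 from rfl] at h1
  rw [← sub_add_sub_cancel _ (aeval A (1 + C ϖ * (q - 1))) _, smul_add]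
  exact isIntMatrix_add h1 h

/-- **Admissibility is conjugation-equivariant**: `r(kAk⁻¹) − kMk⁻¹ = k·(r(A) − M)·k⁻¹` stays `≡ 0 (mod d)` for `k ∈ GL_N(𝒪)`. [cite: Kottwitz1986, §3] -/
theorem isIntMatrix_inv_smul_aeval_conj_sub_conj (k : GL (Fin N) K) (hk : IsIntMatrix (k : Matrix (Fin N) (Fin N) K))
    (hk' : IsIntMatrix ((k⁻¹ : GL (Fin N) K) : Matrix (Fin N) (Fin N) K)) (A M : Matrix (Fin N) (Fin N) K) (d : K) (p : 𝒪[K][X])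
    (h : IsIntMatrix (d⁻¹ • (aeval A p - M))) :
    IsIntMatrix (d⁻¹ • (aeval ((k : Matrix (Fin N) (Fin N) K) * A * ((k⁻¹ : GL (Fin N) K) : Matrix (Fin N) (Fin N) K)) p -
      (k : Matrix (Fin N) (Fin N) K) * M * ((k⁻¹ : GL (Fin N) K) : Matrix (Fin N) (Fin N) K))) := by
  have hc := aeval_units_conj k⁻¹ A p
  rw [inv_inv] at hc
  rw [hc, ← Matrix.sub_mul, ← Matrix.mul_sub, ← Matrix.smul_mul, ← Matrix.mul_smul]
  exact isIntMatrix_mul (isIntMatrix_mul hk h) hk'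

end Matrices

section Place

variable (L : Type) [Field L] [NumberField L] [IsCMField L] (N : ℕ) (H : Matrix (Fin N) (Fin N) L)
  {v : HeightOneSpectrum (𝓞 ↥(maximalRealSubfield L))} (hc : IsCMField.complexConj L ≠ 1)
  (w : UnitaryGroup.PlacesOver L v) (hw : IsCMField.complexConj L • w.1 = w.1)

/-! ## §1 Plumbing: the level-one set is open and inside `K`; invariance ⇒ `IsLocSmooth`; congruent elements give equal values -/

omit [IsCMField L] in
/-- `{x ∈ L_w : |x| ≤ |ϖ|}` is open (`ϖ ≠ 0`). [cite: BernsteinZelevinsky1976, §1.1] -/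
theorem isOpen_setOf_v_le_v {ϖ : w.1.adicCompletion L} (hϖ0 : ϖ ≠ 0) : IsOpen {x : w.1.adicCompletion L | Valued.v x ≤ Valued.v ϖ} := by
  simpa only [Valuation.restrict_le_iff] using
    Valued.isOpen_closedBall (w.1.adicCompletion L) (r := Valued.v.restrict ϖ)
      (by rw [Ne, Valuation.restrict_eq_zero_iff]; exact (Valuation.ne_zero_iff _).2 hϖ0)

/-- `x ↦ (e x)_w` is continuous `G → M_N(L_w)`. [cite: PlatonovRapinchuk1994, §5.1] -/
theorem continuous_coe_localNonsplitEquiv :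
    Continuous fun x : (cmDatum L N H).Local v => (((localNonsplitEquiv (IsCMField.complexConj L) H hc w hw x :
      ↥(unitaryGroupOfForm (galAdicCompletionMap (L := L) (IsCMField.complexConj L) hw) (placeForm H w.1))) : GL (Fin N) (w.1.adicCompletion L)) :
        Matrix (Fin N) (Fin N) (w.1.adicCompletion L)) :=
  Units.continuous_val.comp (continuous_subtype_val.comp (localNonsplitEquiv (IsCMField.complexConj L) H hc w hw).continuous)

/-- **The level set «`U_w ≡ 1 (mod ϖ^j)`» is open in `G`.** [cite: BernsteinZelevinsky1976, §1.1] [cite: PlatonovRapinchuk1994, §5.1] -/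
theorem isOpen_setOf_level {ϖ : w.1.adicCompletion L} (hϖ0 : ϖ ≠ 0) (j : ℕ) :
    IsOpen {U : (cmDatum L N H).Local v | IsIntMatrix ((ϖ ^ j)⁻¹ • ((((localNonsplitEquiv (IsCMField.complexConj L) H hc w hw U :
      ↥(unitaryGroupOfForm (galAdicCompletionMap (L := L) (IsCMField.complexConj L) hw) (placeForm H w.1))) : GL (Fin N) (w.1.adicCompletion L)) :
        Matrix (Fin N) (Fin N) (w.1.adicCompletion L)) - 1))} := by
  have hϖj : ϖ ^ j ≠ 0 := pow_ne_zero _ hϖ0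
  have hset : {U : (cmDatum L N H).Local v | IsIntMatrix ((ϖ ^ j)⁻¹ • ((((localNonsplitEquiv (IsCMField.complexConj L) H hc w hw U :
      ↥(unitaryGroupOfForm (galAdicCompletionMap (L := L) (IsCMField.complexConj L) hw) (placeForm H w.1))) : GL (Fin N) (w.1.adicCompletion L)) :
        Matrix (Fin N) (Fin N) (w.1.adicCompletion L)) - 1))} =
      ⋂ i : Fin N, ⋂ k : Fin N, (fun U : (cmDatum L N H).Local v => ((((localNonsplitEquiv (IsCMField.complexConj L) H hc w hw U :
        ↥(unitaryGroupOfForm (galAdicCompletionMap (L := L) (IsCMField.complexConj L) hw) (placeForm H w.1))) : GL (Fin N) (w.1.adicCompletion L)) :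
          Matrix (Fin N) (Fin N) (w.1.adicCompletion L)) - 1) i k) ⁻¹' {x : w.1.adicCompletion L | Valued.v x ≤ Valued.v (ϖ ^ j)} := by
    ext U
    simp only [mem_setOf_eq, mem_iInter, mem_preimage, isIntMatrix_inv_smul_iff hϖj]
  rw [hset]
  exact isOpen_iInter_of_finite fun i => isOpen_iInter_of_finite fun k =>
    (isOpen_setOf_v_le_v L w hϖj).preimage ((continuous_apply k).comp ((continuous_apply i).comp
      ((continuous_coe_localNonsplitEquiv L N H hc w hw).sub continuous_const)))

/-- **«`U_w ≡ 1 (mod ϖ^j)`» with `|ϖ| < 1`, `j ≥ 1` ⇒ `U ∈ K`** (`e U` and `(e U)⁻¹` are integral, ★ C1 §2). [cite: Kottwitz1986, §3] -/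
theorem mem_cmLocalIntegralLevel_of_level {ϖ : w.1.adicCompletion L} (hϖ0 : ϖ ≠ 0) (hϖ1 : Valued.v ϖ < 1) {j : ℕ} (hj : 1 ≤ j) (U : (cmDatum L N H).Local v)
    (hU : IsIntMatrix ((ϖ ^ j)⁻¹ • ((((localNonsplitEquiv (IsCMField.complexConj L) H hc w hw U :
      ↥(unitaryGroupOfForm (galAdicCompletionMap (L := L) (IsCMField.complexConj L) hw) (placeForm H w.1))) : GL (Fin N) (w.1.adicCompletion L)) :
        Matrix (Fin N) (Fin N) (w.1.adicCompletion L)) - 1))) :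
    U ∈ cmLocalIntegralLevel L N H v := by
  rw [isIntMatrix_inv_smul_iff (pow_ne_zero _ hϖ0)] at hU
  have hlt : ∀ i k, Valued.v (((((localNonsplitEquiv (IsCMField.complexConj L) H hc w hw U :
      ↥(unitaryGroupOfForm (galAdicCompletionMap (L := L) (IsCMField.complexConj L) hw) (placeForm H w.1))) : GL (Fin N) (w.1.adicCompletion L)) :
        Matrix (Fin N) (Fin N) (w.1.adicCompletion L)) - 1) i k) < 1 := fun i k =>
    (hU i k).trans_lt (by rw [map_pow]; exact pow_lt_one₀ zero_le hϖ1 (by omega))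
  rw [mem_cmLocalIntegralLevel_iff_isIntMatrix L N H hc w hw, Matrix.coe_units_inv]
  exact ⟨isIntMatrix_of_forall_v_sub_one_lt_one _ hlt, isIntMatrix_nonsing_inv_of_forall_v_sub_one_lt_one _ hlt⟩

/-- **A `K`-supported function left-invariant under «`≡ 1 (mod ϖ^j)`» is `IsLocSmooth` with `tsupport ⊆ K`.** [cite: BernsteinZelevinsky1976, §1.1] [cite: Rogawski1990, §1.6 p. 6] -/
theorem isLocSmooth_of_level_invariant_of_support_subset {ϖ : w.1.adicCompletion L} (hϖ0 : ϖ ≠ 0) (j : ℕ) (f : (cmDatum L N H).Local v → ℂ)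
    (hf : ∀ U : (cmDatum L N H).Local v, IsIntMatrix ((ϖ ^ j)⁻¹ • ((((localNonsplitEquiv (IsCMField.complexConj L) H hc w hw U :
      ↥(unitaryGroupOfForm (galAdicCompletionMap (L := L) (IsCMField.complexConj L) hw) (placeForm H w.1))) : GL (Fin N) (w.1.adicCompletion L)) :
        Matrix (Fin N) (Fin N) (w.1.adicCompletion L)) - 1)) → ∀ x, f (U * x) = f x)
    (hfK : Function.support f ⊆ (cmLocalIntegralLevel L N H v : Set ((cmDatum L N H).Local v))) :
    Literature.NumberTheory.Rogawski1990.IsLocSmooth f ∧ tsupport f ⊆ (cmLocalIntegralLevel L N H v : Set ((cmDatum L N H).Local v)) := by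
  have hKco := isCompact_isOpen_cmLocalIntegralLevel L N H v
  have hKcl : IsClosed (cmLocalIntegralLevel L N H v : Set ((cmDatum L N H).Local v)) := Subgroup.isClosed_of_isOpen _ hKco.2
  have hts : tsupport f ⊆ (cmLocalIntegralLevel L N H v : Set ((cmDatum L N H).Local v)) := closure_minimal hfK hKcl
  refine ⟨⟨?_, IsCompact.of_isClosed_subset hKco.1 isClosed_closure hts⟩, hts⟩
  rw [IsLocallyConstant.iff_exists_open]
  intro x
  refine ⟨(fun y => y * x⁻¹) ⁻¹' {U : (cmDatum L N H).Local v | IsIntMatrix ((ϖ ^ j)⁻¹ • ((((localNonsplitEquiv (IsCMField.complexConj L) H hc w hw U :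
      ↥(unitaryGroupOfForm (galAdicCompletionMap (L := L) (IsCMField.complexConj L) hw) (placeForm H w.1))) : GL (Fin N) (w.1.adicCompletion L)) :
        Matrix (Fin N) (Fin N) (w.1.adicCompletion L)) - 1))},
    (isOpen_setOf_level L N H hc w hw hϖ0 j).preimage (continuous_id.mul continuous_const), ?_, fun y hy => ?_⟩
  · have h1 : localNonsplitEquiv (IsCMField.complexConj L) H hc w hw (x * x⁻¹) = 1 := by
      rw [mul_inv_cancel]; exact map_one (localNonsplitEquiv (IsCMField.complexConj L) H hc w hw)
    simp only [mem_preimage, mem_setOf_eq]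
    rw [h1, OneMemClass.coe_one, Units.val_one, sub_self, smul_zero]
    exact isIntMatrix_zero
  · have h := hf (y * x⁻¹) hy x
    rwa [inv_mul_cancel_right] at h

/-- **Congruent `mod ϖ²` ⇒ equal values** of a function left-invariant under «`≡ 1 (mod ϖ²)`»: `x_w ≡ (k₂)_w (mod ϖ²)` with `k₂ ∈ K` ⇒ `ψ x = ψ k₂` (`x = U·k₂`,
`U_w − 1 = (x_w − (k₂)_w)(k₂)_w⁻¹`). [cite: Kottwitz1986, §3] -/
theorem apply_eq_of_congr_levelTwo {β : Type*} (ψ : (cmDatum L N H).Local v → β) {ϖ : w.1.adicCompletion L}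
    (hψ2 : ∀ U : (cmDatum L N H).Local v, IsIntMatrix ((ϖ ^ 2)⁻¹ • ((((localNonsplitEquiv (IsCMField.complexConj L) H hc w hw U :
        ↥(unitaryGroupOfForm (galAdicCompletionMap (L := L) (IsCMField.complexConj L) hw) (placeForm H w.1))) : GL (Fin N) (w.1.adicCompletion L)) :
          Matrix (Fin N) (Fin N) (w.1.adicCompletion L)) - 1)) → ∀ x, ψ (U * x) = ψ x)
    (x k₂ : (cmDatum L N H).Local v) (hk₂ : k₂ ∈ cmLocalIntegralLevel L N H v)
    (h : IsIntMatrix ((ϖ ^ 2)⁻¹ • ((((localNonsplitEquiv (IsCMField.complexConj L) H hc w hw x :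
        ↥(unitaryGroupOfForm (galAdicCompletionMap (L := L) (IsCMField.complexConj L) hw) (placeForm H w.1))) : GL (Fin N) (w.1.adicCompletion L)) :
          Matrix (Fin N) (Fin N) (w.1.adicCompletion L)) -
      (((localNonsplitEquiv (IsCMField.complexConj L) H hc w hw k₂ :
        ↥(unitaryGroupOfForm (galAdicCompletionMap (L := L) (IsCMField.complexConj L) hw) (placeForm H w.1))) : GL (Fin N) (w.1.adicCompletion L)) :
          Matrix (Fin N) (Fin N) (w.1.adicCompletion L))))) :
    ψ x = ψ k₂ := by
  have hek₂i := ((mem_cmLocalIntegralLevel_iff_isIntMatrix L N H hc w hw _).1 hk₂).2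
  have hU : IsIntMatrix ((ϖ ^ 2)⁻¹ • ((((localNonsplitEquiv (IsCMField.complexConj L) H hc w hw (x * k₂⁻¹) :
        ↥(unitaryGroupOfForm (galAdicCompletionMap (L := L) (IsCMField.complexConj L) hw) (placeForm H w.1))) : GL (Fin N) (w.1.adicCompletion L)) :
          Matrix (Fin N) (Fin N) (w.1.adicCompletion L)) - 1)) := by
    rw [coe_localNonsplitEquiv_mul_inv L N H hc w hw, Units.val_mul]
    have e : ((((localNonsplitEquiv (IsCMField.complexConj L) H hc w hw x :
          ↥(unitaryGroupOfForm (galAdicCompletionMap (L := L) (IsCMField.complexConj L) hw) (placeForm H w.1))) : GL (Fin N) (w.1.adicCompletion L)) :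
            Matrix (Fin N) (Fin N) (w.1.adicCompletion L)) *
          ((((localNonsplitEquiv (IsCMField.complexConj L) H hc w hw k₂ :
            ↥(unitaryGroupOfForm (galAdicCompletionMap (L := L) (IsCMField.complexConj L) hw) (placeForm H w.1))) : GL (Fin N) (w.1.adicCompletion L))⁻¹ :
              GL (Fin N) (w.1.adicCompletion L)) : Matrix (Fin N) (Fin N) (w.1.adicCompletion L)) - 1) =
        ((((localNonsplitEquiv (IsCMField.complexConj L) H hc w hw x :
          ↥(unitaryGroupOfForm (galAdicCompletionMap (L := L) (IsCMField.complexConj L) hw) (placeForm H w.1))) : GL (Fin N) (w.1.adicCompletion L)) :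
            Matrix (Fin N) (Fin N) (w.1.adicCompletion L)) -
          (((localNonsplitEquiv (IsCMField.complexConj L) H hc w hw k₂ :
            ↥(unitaryGroupOfForm (galAdicCompletionMap (L := L) (IsCMField.complexConj L) hw) (placeForm H w.1))) : GL (Fin N) (w.1.adicCompletion L)) :
              Matrix (Fin N) (Fin N) (w.1.adicCompletion L))) *
          ((((localNonsplitEquiv (IsCMField.complexConj L) H hc w hw k₂ :
            ↥(unitaryGroupOfForm (galAdicCompletionMap (L := L) (IsCMField.complexConj L) hw) (placeForm H w.1))) : GL (Fin N) (w.1.adicCompletion L))⁻¹ :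
              GL (Fin N) (w.1.adicCompletion L)) : Matrix (Fin N) (Fin N) (w.1.adicCompletion L)) := by
      rw [Matrix.sub_mul, Units.mul_inv]
    rw [e, ← Matrix.smul_mul]
    exact isIntMatrix_mul h hek₂i
  have hfin := hψ2 _ hU k₂
  rwa [inv_mul_cancel_right] at hfin

/-- `e (k x k⁻¹) = e k · e x · (e k)⁻¹` in `GL_N(L_w)`. [cite: PlatonovRapinchuk1994, §5.1] -/
theorem coe_localNonsplitEquiv_conj' (k x : (cmDatum L N H).Local v) :
    ((localNonsplitEquiv (IsCMField.complexConj L) H hc w hw (k * x * k⁻¹) :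
        ↥(unitaryGroupOfForm (galAdicCompletionMap (L := L) (IsCMField.complexConj L) hw) (placeForm H w.1))) : GL (Fin N) (w.1.adicCompletion L)) =
      ((localNonsplitEquiv (IsCMField.complexConj L) H hc w hw k :
          ↥(unitaryGroupOfForm (galAdicCompletionMap (L := L) (IsCMField.complexConj L) hw) (placeForm H w.1))) : GL (Fin N) (w.1.adicCompletion L)) *
        ((localNonsplitEquiv (IsCMField.complexConj L) H hc w hw x :
          ↥(unitaryGroupOfForm (galAdicCompletionMap (L := L) (IsCMField.complexConj L) hw) (placeForm H w.1))) : GL (Fin N) (w.1.adicCompletion L)) *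
        ((localNonsplitEquiv (IsCMField.complexConj L) H hc w hw k :
          ↥(unitaryGroupOfForm (galAdicCompletionMap (L := L) (IsCMField.complexConj L) hw) (placeForm H w.1))) : GL (Fin N) (w.1.adicCompletion L))⁻¹ := by
  have h1 : localNonsplitEquiv (IsCMField.complexConj L) H hc w hw (k * x * k⁻¹) =
      localNonsplitEquiv (IsCMField.complexConj L) H hc w hw (k * x) * localNonsplitEquiv (IsCMField.complexConj L) H hc w hw k⁻¹ :=
    map_mul (localNonsplitEquiv (IsCMField.complexConj L) H hc w hw) _ _
  have h2 : localNonsplitEquiv (IsCMField.complexConj L) H hc w hw (k * x) =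
      localNonsplitEquiv (IsCMField.complexConj L) H hc w hw k * localNonsplitEquiv (IsCMField.complexConj L) H hc w hw x :=
    map_mul (localNonsplitEquiv (IsCMField.complexConj L) H hc w hw) _ _
  have h3 : localNonsplitEquiv (IsCMField.complexConj L) H hc w hw k⁻¹ = (localNonsplitEquiv (IsCMField.complexConj L) H hc w hw k)⁻¹ :=
    map_inv (localNonsplitEquiv (IsCMField.complexConj L) H hc w hw) _
  rw [h1, h2, h3, Subgroup.coe_mul, Subgroup.coe_mul, Subgroup.coe_inv]

/-- Matrix form of `coe_localNonsplitEquiv_conj'`: `(e (k x k⁻¹))_w = k_w · x_w · (k_w)⁻¹` as matrices. [cite: PlatonovRapinchuk1994, §5.1] -/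
theorem coe_coe_localNonsplitEquiv_conj' (k x : (cmDatum L N H).Local v) :
    (((localNonsplitEquiv (IsCMField.complexConj L) H hc w hw (k * x * k⁻¹) :
        ↥(unitaryGroupOfForm (galAdicCompletionMap (L := L) (IsCMField.complexConj L) hw) (placeForm H w.1))) : GL (Fin N) (w.1.adicCompletion L)) :
          Matrix (Fin N) (Fin N) (w.1.adicCompletion L)) =
      (((localNonsplitEquiv (IsCMField.complexConj L) H hc w hw k :
        ↥(unitaryGroupOfForm (galAdicCompletionMap (L := L) (IsCMField.complexConj L) hw) (placeForm H w.1))) : GL (Fin N) (w.1.adicCompletion L)) :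
          Matrix (Fin N) (Fin N) (w.1.adicCompletion L)) * (((localNonsplitEquiv (IsCMField.complexConj L) H hc w hw x :
        ↥(unitaryGroupOfForm (galAdicCompletionMap (L := L) (IsCMField.complexConj L) hw) (placeForm H w.1))) : GL (Fin N) (w.1.adicCompletion L)) :
          Matrix (Fin N) (Fin N) (w.1.adicCompletion L)) *
        ((((localNonsplitEquiv (IsCMField.complexConj L) H hc w hw k :
        ↥(unitaryGroupOfForm (galAdicCompletionMap (L := L) (IsCMField.complexConj L) hw) (placeForm H w.1))) : GL (Fin N) (w.1.adicCompletion L))⁻¹ : GL (Fin N) (w.1.adicCompletion L)) : Matrix (Fin N) (Fin N) (w.1.adicCompletion L)) := by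
  rw [coe_localNonsplitEquiv_conj' L N H hc w hw k x, Units.val_mul, Units.val_mul]

/-- `e (U x) = e U · e x`. [cite: PlatonovRapinchuk1994, §5.1] -/
theorem coe_localNonsplitEquiv_mul (U x : (cmDatum L N H).Local v) :
    ((localNonsplitEquiv (IsCMField.complexConj L) H hc w hw (U * x) :
        ↥(unitaryGroupOfForm (galAdicCompletionMap (L := L) (IsCMField.complexConj L) hw) (placeForm H w.1))) : GL (Fin N) (w.1.adicCompletion L)) =
      ((localNonsplitEquiv (IsCMField.complexConj L) H hc w hw U :
          ↥(unitaryGroupOfForm (galAdicCompletionMap (L := L) (IsCMField.complexConj L) hw) (placeForm H w.1))) : GL (Fin N) (w.1.adicCompletion L)) *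
        ((localNonsplitEquiv (IsCMField.complexConj L) H hc w hw x :
          ↥(unitaryGroupOfForm (galAdicCompletionMap (L := L) (IsCMField.complexConj L) hw) (placeForm H w.1))) : GL (Fin N) (w.1.adicCompletion L)) := by
  have h1 : localNonsplitEquiv (IsCMField.complexConj L) H hc w hw (U * x) =
      localNonsplitEquiv (IsCMField.complexConj L) H hc w hw U * localNonsplitEquiv (IsCMField.complexConj L) H hc w hw x :=
    map_mul (localNonsplitEquiv (IsCMField.complexConj L) H hc w hw) _ _
  rw [h1, Subgroup.coe_mul]

/-- **Element form of ★ `sep_fixedBy_interior_eq_fixedBy_of_mem_adjoin`**: `g⁻¹ug ∈ K ↔ (g⁻¹γg ∈ K ∧ (g⁻¹γg)_w ≡ 1 (mod ϖ))` under the CAYLEY triple. [cite: Kottwitz1986, §3]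
[cite: Laumon1995, Lemma (5.3.2) p. 136] -/
theorem conj_mem_and_interior_iff_conj_mem {ϖ : w.1.adicCompletion L} (hϖ0 : ϖ ≠ 0) (hϖ1 : Valued.v ϖ < 1) (γ u : (cmDatum L N H).Local v)
    (hu : (((localNonsplitEquiv (IsCMField.complexConj L) H hc w hw u :
        ↥(unitaryGroupOfForm (galAdicCompletionMap (L := L) (IsCMField.complexConj L) hw) (placeForm H w.1))) : GL (Fin N) (w.1.adicCompletion L)) :
          Matrix (Fin N) (Fin N) (w.1.adicCompletion L)) ∈
      Algebra.adjoin 𝒪[w.1.adicCompletion L] ({1 + ϖ⁻¹ • ((((localNonsplitEquiv (IsCMField.complexConj L) H hc w hw γ :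
        ↥(unitaryGroupOfForm (galAdicCompletionMap (L := L) (IsCMField.complexConj L) hw) (placeForm H w.1))) : GL (Fin N) (w.1.adicCompletion L)) :
          Matrix (Fin N) (Fin N) (w.1.adicCompletion L)) - 1)} : Set (Matrix (Fin N) (Fin N) (w.1.adicCompletion L))))
    (hu' : ((((localNonsplitEquiv (IsCMField.complexConj L) H hc w hw u :
        ↥(unitaryGroupOfForm (galAdicCompletionMap (L := L) (IsCMField.complexConj L) hw) (placeForm H w.1))) : GL (Fin N) (w.1.adicCompletion L))⁻¹ :
          GL (Fin N) (w.1.adicCompletion L)) : Matrix (Fin N) (Fin N) (w.1.adicCompletion L)) ∈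
      Algebra.adjoin 𝒪[w.1.adicCompletion L] ({1 + ϖ⁻¹ • ((((localNonsplitEquiv (IsCMField.complexConj L) H hc w hw γ :
        ↥(unitaryGroupOfForm (galAdicCompletionMap (L := L) (IsCMField.complexConj L) hw) (placeForm H w.1))) : GL (Fin N) (w.1.adicCompletion L)) :
          Matrix (Fin N) (Fin N) (w.1.adicCompletion L)) - 1)} : Set (Matrix (Fin N) (Fin N) (w.1.adicCompletion L))))
    (hX : (1 + ϖ⁻¹ • ((((localNonsplitEquiv (IsCMField.complexConj L) H hc w hw γ :
        ↥(unitaryGroupOfForm (galAdicCompletionMap (L := L) (IsCMField.complexConj L) hw) (placeForm H w.1))) : GL (Fin N) (w.1.adicCompletion L)) :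
          Matrix (Fin N) (Fin N) (w.1.adicCompletion L)) - 1)) ∈
      Algebra.adjoin 𝒪[w.1.adicCompletion L] ({(((localNonsplitEquiv (IsCMField.complexConj L) H hc w hw u :
        ↥(unitaryGroupOfForm (galAdicCompletionMap (L := L) (IsCMField.complexConj L) hw) (placeForm H w.1))) : GL (Fin N) (w.1.adicCompletion L)) :
          Matrix (Fin N) (Fin N) (w.1.adicCompletion L))} : Set (Matrix (Fin N) (Fin N) (w.1.adicCompletion L))))
    (g : (cmDatum L N H).Local v) :
    g⁻¹ * u * g ∈ cmLocalIntegralLevel L N H v ↔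
      g⁻¹ * γ * g ∈ cmLocalIntegralLevel L N H v ∧ IsIntMatrix (ϖ⁻¹ • ((((localNonsplitEquiv (IsCMField.complexConj L) H hc w hw (g⁻¹ * γ * g) :
        ↥(unitaryGroupOfForm (galAdicCompletionMap (L := L) (IsCMField.complexConj L) hw) (placeForm H w.1))) : GL (Fin N) (w.1.adicCompletion L)) :
          Matrix (Fin N) (Fin N) (w.1.adicCompletion L)) - 1)) := by
  have e1 : ∀ A B : GL (Fin N) (w.1.adicCompletion L), (A⁻¹ * B * A)⁻¹ = A⁻¹ * B⁻¹ * A := fun A B => by group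
  rw [mem_cmLocalIntegralLevel_iff_isIntMatrix L N H hc w hw, mem_cmLocalIntegralLevel_iff_isIntMatrix L N H hc w hw,
    coe_localNonsplitEquiv_conj L N H hc w hw g γ, coe_localNonsplitEquiv_conj L N H hc w hw g u]
  generalize ((localNonsplitEquiv (IsCMField.complexConj L) H hc w hw g :
      ↥(unitaryGroupOfForm (galAdicCompletionMap (L := L) (IsCMField.complexConj L) hw) (placeForm H w.1))) : GL (Fin N) (w.1.adicCompletion L)) = A
  rw [e1, e1]
  refine Iff.trans (mapGL_latt_eq_latt_iff _ A).symm ?_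
  refine Iff.trans (mapGL_eq_iff_map_toLin'_le _ _ hu hu' hX) ?_
  refine Iff.trans (mapGL_eq_and_level_iff_map_levelShift_le hϖ0 hϖ1 _ A).symm ?_
  exact and_congr (mapGL_latt_eq_latt_iff _ A) ((map_sub_one_latt_le_scaleLattice_iff hϖ0 _ A).trans (isIntMatrix_inv_smul_iff hϖ0 _).symm)

/-- **The level set is inverse-closed**: `U_w ≡ 1 (mod ϖ^j)`, `j ≥ 1` ⇒ `(U⁻¹)_w ≡ 1 (mod ϖ^j)` (`(e U)⁻¹ − 1 = −(e U)⁻¹·(e U − 1)`, `(e U)⁻¹` integral).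
[cite: Kottwitz1986, §3] -/
theorem level_inv_of_level {ϖ : w.1.adicCompletion L} (hϖ0 : ϖ ≠ 0) (hϖ1 : Valued.v ϖ < 1) {j : ℕ} (hj : 1 ≤ j) (U : (cmDatum L N H).Local v)
    (hU : IsIntMatrix ((ϖ ^ j)⁻¹ • ((((localNonsplitEquiv (IsCMField.complexConj L) H hc w hw U :
        ↥(unitaryGroupOfForm (galAdicCompletionMap (L := L) (IsCMField.complexConj L) hw) (placeForm H w.1))) : GL (Fin N) (w.1.adicCompletion L)) :
          Matrix (Fin N) (Fin N) (w.1.adicCompletion L)) - 1))) :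
    IsIntMatrix ((ϖ ^ j)⁻¹ • ((((localNonsplitEquiv (IsCMField.complexConj L) H hc w hw U⁻¹ :
        ↥(unitaryGroupOfForm (galAdicCompletionMap (L := L) (IsCMField.complexConj L) hw) (placeForm H w.1))) : GL (Fin N) (w.1.adicCompletion L)) :
          Matrix (Fin N) (Fin N) (w.1.adicCompletion L)) - 1)) := by
  have hUK := mem_cmLocalIntegralLevel_of_level L N H hc w hw hϖ0 hϖ1 hj U hU
  have hUi := ((mem_cmLocalIntegralLevel_iff_isIntMatrix L N H hc w hw U).1 hUK).2
  have hinv : localNonsplitEquiv (IsCMField.complexConj L) H hc w hw U⁻¹ = (localNonsplitEquiv (IsCMField.complexConj L) H hc w hw U)⁻¹ :=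
    map_inv (localNonsplitEquiv (IsCMField.complexConj L) H hc w hw) _
  rw [hinv, Subgroup.coe_inv]
  have e : ((((localNonsplitEquiv (IsCMField.complexConj L) H hc w hw U :
        ↥(unitaryGroupOfForm (galAdicCompletionMap (L := L) (IsCMField.complexConj L) hw) (placeForm H w.1))) : GL (Fin N) (w.1.adicCompletion L))⁻¹ : GL (Fin N) (w.1.adicCompletion L)) : Matrix (Fin N) (Fin N) (w.1.adicCompletion L)) - 1 =
      -(((((localNonsplitEquiv (IsCMField.complexConj L) H hc w hw U :
        ↥(unitaryGroupOfForm (galAdicCompletionMap (L := L) (IsCMField.complexConj L) hw) (placeForm H w.1))) : GL (Fin N) (w.1.adicCompletion L))⁻¹ : GL (Fin N) (w.1.adicCompletion L)) : Matrix (Fin N) (Fin N) (w.1.adicCompletion L)) * ((((localNonsplitEquiv (IsCMField.complexConj L) H hc w hw U :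
        ↥(unitaryGroupOfForm (galAdicCompletionMap (L := L) (IsCMField.complexConj L) hw) (placeForm H w.1))) : GL (Fin N) (w.1.adicCompletion L)) :
          Matrix (Fin N) (Fin N) (w.1.adicCompletion L)) - 1)) := by
    rw [Matrix.mul_sub, Matrix.mul_one, ← Units.val_mul, inv_mul_cancel, Units.val_one, neg_sub]
  rw [e, smul_neg, ← Matrix.mul_smul]
  exact isIntMatrix_neg (isIntMatrix_mul hUi hU)

/-- **Admissibility is stable under level-1 left translation**: `U_w ≡ 1 (mod ϖ)`, `x ∈ K`, `r(e x) ≡ e k₂ (mod ϖ²)` ⇒ `r(e(Ux)) ≡ e k₂ (mod ϖ²)` (the LEVEL GAIN).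
[cite: Kottwitz1986, §3] [cite: Rogawski1990, §4.9 Prop. 4.9.1 (a) p. 55] -/
theorem relabel_congr_of_level_mul {ϖ : w.1.adicCompletion L} (hϖ0 : ϖ ≠ 0) (hϖ1 : Valued.v ϖ < 1) (hϖi : ϖ ∈ 𝒪[w.1.adicCompletion L]) (q : (𝒪[w.1.adicCompletion L])[X])
    (U : (cmDatum L N H).Local v) (hU : IsIntMatrix ((ϖ ^ 1)⁻¹ • ((((localNonsplitEquiv (IsCMField.complexConj L) H hc w hw U :
        ↥(unitaryGroupOfForm (galAdicCompletionMap (L := L) (IsCMField.complexConj L) hw) (placeForm H w.1))) : GL (Fin N) (w.1.adicCompletion L)) :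
          Matrix (Fin N) (Fin N) (w.1.adicCompletion L)) - 1)))
    (x : (cmDatum L N H).Local v) (hx : x ∈ cmLocalIntegralLevel L N H v) (k₂ : (cmDatum L N H).Local v)
    (hadm : IsIntMatrix ((ϖ ^ 2)⁻¹ • (aeval (((localNonsplitEquiv (IsCMField.complexConj L) H hc w hw x :
        ↥(unitaryGroupOfForm (galAdicCompletionMap (L := L) (IsCMField.complexConj L) hw) (placeForm H w.1))) : GL (Fin N) (w.1.adicCompletion L)) :
          Matrix (Fin N) (Fin N) (w.1.adicCompletion L)) (1 + C (⟨ϖ, hϖi⟩ : 𝒪[w.1.adicCompletion L]) * (q - 1)) -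
      (((localNonsplitEquiv (IsCMField.complexConj L) H hc w hw k₂ :
        ↥(unitaryGroupOfForm (galAdicCompletionMap (L := L) (IsCMField.complexConj L) hw) (placeForm H w.1))) : GL (Fin N) (w.1.adicCompletion L)) :
          Matrix (Fin N) (Fin N) (w.1.adicCompletion L))))) :
    IsIntMatrix ((ϖ ^ 2)⁻¹ • (aeval (((localNonsplitEquiv (IsCMField.complexConj L) H hc w hw (U * x) :
        ↥(unitaryGroupOfForm (galAdicCompletionMap (L := L) (IsCMField.complexConj L) hw) (placeForm H w.1))) : GL (Fin N) (w.1.adicCompletion L)) :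
          Matrix (Fin N) (Fin N) (w.1.adicCompletion L)) (1 + C (⟨ϖ, hϖi⟩ : 𝒪[w.1.adicCompletion L]) * (q - 1)) -
      (((localNonsplitEquiv (IsCMField.complexConj L) H hc w hw k₂ :
        ↥(unitaryGroupOfForm (galAdicCompletionMap (L := L) (IsCMField.complexConj L) hw) (placeForm H w.1))) : GL (Fin N) (w.1.adicCompletion L)) :
          Matrix (Fin N) (Fin N) (w.1.adicCompletion L)))) := by
  have hKi : ∀ y ∈ cmLocalIntegralLevel L N H v, IsIntMatrix (((localNonsplitEquiv (IsCMField.complexConj L) H hc w hw y :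
        ↥(unitaryGroupOfForm (galAdicCompletionMap (L := L) (IsCMField.complexConj L) hw) (placeForm H w.1))) : GL (Fin N) (w.1.adicCompletion L)) :
          Matrix (Fin N) (Fin N) (w.1.adicCompletion L)) := fun y hy =>
    ((mem_cmLocalIntegralLevel_iff_isIntMatrix L N H hc w hw y).1 hy).1
  have hUK := mem_cmLocalIntegralLevel_of_level L N H hc w hw hϖ0 hϖ1 le_rfl U hU
  have hcongr : IsIntMatrix ((ϖ ^ 1)⁻¹ • ((((localNonsplitEquiv (IsCMField.complexConj L) H hc w hw x :
        ↥(unitaryGroupOfForm (galAdicCompletionMap (L := L) (IsCMField.complexConj L) hw) (placeForm H w.1))) : GL (Fin N) (w.1.adicCompletion L)) :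
          Matrix (Fin N) (Fin N) (w.1.adicCompletion L)) - (((localNonsplitEquiv (IsCMField.complexConj L) H hc w hw (U * x) :
        ↥(unitaryGroupOfForm (galAdicCompletionMap (L := L) (IsCMField.complexConj L) hw) (placeForm H w.1))) : GL (Fin N) (w.1.adicCompletion L)) :
          Matrix (Fin N) (Fin N) (w.1.adicCompletion L)))) := by
    rw [coe_localNonsplitEquiv_mul L N H hc w hw U x, Units.val_mul]
    have e : (((localNonsplitEquiv (IsCMField.complexConj L) H hc w hw x :
        ↥(unitaryGroupOfForm (galAdicCompletionMap (L := L) (IsCMField.complexConj L) hw) (placeForm H w.1))) : GL (Fin N) (w.1.adicCompletion L)) :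
          Matrix (Fin N) (Fin N) (w.1.adicCompletion L)) -
        (((localNonsplitEquiv (IsCMField.complexConj L) H hc w hw U :
        ↥(unitaryGroupOfForm (galAdicCompletionMap (L := L) (IsCMField.complexConj L) hw) (placeForm H w.1))) : GL (Fin N) (w.1.adicCompletion L)) :
          Matrix (Fin N) (Fin N) (w.1.adicCompletion L)) * (((localNonsplitEquiv (IsCMField.complexConj L) H hc w hw x :
        ↥(unitaryGroupOfForm (galAdicCompletionMap (L := L) (IsCMField.complexConj L) hw) (placeForm H w.1))) : GL (Fin N) (w.1.adicCompletion L)) :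
          Matrix (Fin N) (Fin N) (w.1.adicCompletion L)) =
        -(((((localNonsplitEquiv (IsCMField.complexConj L) H hc w hw U :
        ↥(unitaryGroupOfForm (galAdicCompletionMap (L := L) (IsCMField.complexConj L) hw) (placeForm H w.1))) : GL (Fin N) (w.1.adicCompletion L)) :
          Matrix (Fin N) (Fin N) (w.1.adicCompletion L)) - 1) * (((localNonsplitEquiv (IsCMField.complexConj L) H hc w hw x :
        ↥(unitaryGroupOfForm (galAdicCompletionMap (L := L) (IsCMField.complexConj L) hw) (placeForm H w.1))) : GL (Fin N) (w.1.adicCompletion L)) :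
          Matrix (Fin N) (Fin N) (w.1.adicCompletion L))) := by
      rw [Matrix.sub_mul, Matrix.one_mul, neg_sub]
    rw [e, smul_neg, ← Matrix.smul_mul]
    exact isIntMatrix_neg (isIntMatrix_mul hU (hKi x hx))
  exact isIntMatrix_relabel_sub_of_congr (ϖ := (⟨ϖ, hϖi⟩ : 𝒪[w.1.adicCompletion L])) (hKi x hx) (hKi _ (mul_mem hUK hx)) hϖ0 hcongr q hadm

/-- **Admissibility is stable under `K`-conjugation**: `r(e(kxk⁻¹)) ≡ e(kk₂k⁻¹) (mod ϖ²)` if `r(e x) ≡ e k₂ (mod ϖ²)`, `k ∈ K`. [cite: Kottwitz1986, §3] -/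
theorem relabel_congr_of_conj {ϖ : w.1.adicCompletion L} (hϖi : ϖ ∈ 𝒪[w.1.adicCompletion L]) (q : (𝒪[w.1.adicCompletion L])[X])
    (k : (cmDatum L N H).Local v) (hk : k ∈ cmLocalIntegralLevel L N H v) (x k₂ : (cmDatum L N H).Local v)
    (hadm : IsIntMatrix ((ϖ ^ 2)⁻¹ • (aeval (((localNonsplitEquiv (IsCMField.complexConj L) H hc w hw x :
        ↥(unitaryGroupOfForm (galAdicCompletionMap (L := L) (IsCMField.complexConj L) hw) (placeForm H w.1))) : GL (Fin N) (w.1.adicCompletion L)) :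
          Matrix (Fin N) (Fin N) (w.1.adicCompletion L)) (1 + C (⟨ϖ, hϖi⟩ : 𝒪[w.1.adicCompletion L]) * (q - 1)) -
      (((localNonsplitEquiv (IsCMField.complexConj L) H hc w hw k₂ :
        ↥(unitaryGroupOfForm (galAdicCompletionMap (L := L) (IsCMField.complexConj L) hw) (placeForm H w.1))) : GL (Fin N) (w.1.adicCompletion L)) :
          Matrix (Fin N) (Fin N) (w.1.adicCompletion L))))) :
    IsIntMatrix ((ϖ ^ 2)⁻¹ • (aeval (((localNonsplitEquiv (IsCMField.complexConj L) H hc w hw (k * x * k⁻¹) :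
        ↥(unitaryGroupOfForm (galAdicCompletionMap (L := L) (IsCMField.complexConj L) hw) (placeForm H w.1))) : GL (Fin N) (w.1.adicCompletion L)) :
          Matrix (Fin N) (Fin N) (w.1.adicCompletion L)) (1 + C (⟨ϖ, hϖi⟩ : 𝒪[w.1.adicCompletion L]) * (q - 1)) -
      (((localNonsplitEquiv (IsCMField.complexConj L) H hc w hw (k * k₂ * k⁻¹) :
        ↥(unitaryGroupOfForm (galAdicCompletionMap (L := L) (IsCMField.complexConj L) hw) (placeForm H w.1))) : GL (Fin N) (w.1.adicCompletion L)) :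
          Matrix (Fin N) (Fin N) (w.1.adicCompletion L)))) := by
  have hk1 := ((mem_cmLocalIntegralLevel_iff_isIntMatrix L N H hc w hw k).1 hk)
  rw [coe_coe_localNonsplitEquiv_conj' L N H hc w hw k x, coe_coe_localNonsplitEquiv_conj' L N H hc w hw k k₂]
  exact isIntMatrix_inv_smul_aeval_conj_sub_conj _ hk1.1 hk1.2 _ _ _ _ hadm

/-! ## §2 The interior level-one piece `g′` of a level-two piece `g` -/

-- the statement and proof carry several dozen one-place-model coercions `↑(e x)`; their elaboration (not proof search) exceeds the default budget
set_option maxHeartbeats 400000 in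
/-- **THE INTERIOR PIECE `g′ = 1_K·(g ∘ relabel)`** (A-88 (6)(ii), A-91 (3), A-96 (3)): for `γ u ∈ G` with CAYLEY data (`q(e u) = 1 + ϖ⁻¹(e γ − 1)`, the `adjoin` triple),
`0 < |ϖ| < 1`, and a function `g : G → ℂ` that is Ad(`K`)-invariant and left-invariant under «`≡ 1 (mod ϖ²)`» (no other property of `g` is used), there is `g′ : G → ℂ` with:
`IsLocSmooth g′`, `tsupport g′ ⊆ K`, Ad(`K`)-invariance, left-invariance under «`≡ 1 (mod ϖ^1)`» (a LEVEL-1 PIECE), the VALUE FORMULA `g′ x = g k₂` whenever `x, k₂ ∈ K` and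
`r(e x) ≡ e k₂ (mod ϖ²)` (`r = 1 + ϖ·(q − 1)`; Jordan values `g(1), g(1 + ϖN_tv), g(1 + ϖN_reg)` at the END's representatives), and `g′(g₀⁻¹ u g₀) = g(g₀⁻¹ γ g₀)` on every
fixed coset `g₀K` of `u`.  Construction: `g′ x := g k₂` for any admissible `k₂` (`0` if none or `x ∉ K`), well defined by the LEVEL GAIN. [cite: Kottwitz1986, §3]
[cite: Rogawski1990, §4.9 Prop. 4.9.1 (a) p. 55; §1.6 p. 6] [cite: BernsteinZelevinsky1976, §1.1] -/
theorem exists_levelOne_piece_interior {ϖ : w.1.adicCompletion L} (hϖ0 : ϖ ≠ 0) (hϖ1 : Valued.v ϖ < 1) (hϖi : ϖ ∈ 𝒪[w.1.adicCompletion L])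
    (γ u : (cmDatum L N H).Local v) (q : (𝒪[w.1.adicCompletion L])[X])
    (hq : aeval (((localNonsplitEquiv (IsCMField.complexConj L) H hc w hw u :
        ↥(unitaryGroupOfForm (galAdicCompletionMap (L := L) (IsCMField.complexConj L) hw) (placeForm H w.1))) : GL (Fin N) (w.1.adicCompletion L)) :
          Matrix (Fin N) (Fin N) (w.1.adicCompletion L)) q =
      1 + ϖ⁻¹ • ((((localNonsplitEquiv (IsCMField.complexConj L) H hc w hw γ :
        ↥(unitaryGroupOfForm (galAdicCompletionMap (L := L) (IsCMField.complexConj L) hw) (placeForm H w.1))) : GL (Fin N) (w.1.adicCompletion L)) :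
          Matrix (Fin N) (Fin N) (w.1.adicCompletion L)) - 1))
    (hu : (((localNonsplitEquiv (IsCMField.complexConj L) H hc w hw u :
        ↥(unitaryGroupOfForm (galAdicCompletionMap (L := L) (IsCMField.complexConj L) hw) (placeForm H w.1))) : GL (Fin N) (w.1.adicCompletion L)) :
          Matrix (Fin N) (Fin N) (w.1.adicCompletion L)) ∈
      Algebra.adjoin 𝒪[w.1.adicCompletion L] ({(1 + ϖ⁻¹ • ((((localNonsplitEquiv (IsCMField.complexConj L) H hc w hw γ :
        ↥(unitaryGroupOfForm (galAdicCompletionMap (L := L) (IsCMField.complexConj L) hw) (placeForm H w.1))) : GL (Fin N) (w.1.adicCompletion L)) :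
          Matrix (Fin N) (Fin N) (w.1.adicCompletion L)) - 1))} : Set (Matrix (Fin N) (Fin N) (w.1.adicCompletion L))))
    (hu' : ((((localNonsplitEquiv (IsCMField.complexConj L) H hc w hw u :
        ↥(unitaryGroupOfForm (galAdicCompletionMap (L := L) (IsCMField.complexConj L) hw) (placeForm H w.1))) : GL (Fin N) (w.1.adicCompletion L))⁻¹ :
          GL (Fin N) (w.1.adicCompletion L)) : Matrix (Fin N) (Fin N) (w.1.adicCompletion L)) ∈
      Algebra.adjoin 𝒪[w.1.adicCompletion L] ({(1 + ϖ⁻¹ • ((((localNonsplitEquiv (IsCMField.complexConj L) H hc w hw γ :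
        ↥(unitaryGroupOfForm (galAdicCompletionMap (L := L) (IsCMField.complexConj L) hw) (placeForm H w.1))) : GL (Fin N) (w.1.adicCompletion L)) :
          Matrix (Fin N) (Fin N) (w.1.adicCompletion L)) - 1))} : Set (Matrix (Fin N) (Fin N) (w.1.adicCompletion L))))
    (hX : (1 + ϖ⁻¹ • ((((localNonsplitEquiv (IsCMField.complexConj L) H hc w hw γ :
        ↥(unitaryGroupOfForm (galAdicCompletionMap (L := L) (IsCMField.complexConj L) hw) (placeForm H w.1))) : GL (Fin N) (w.1.adicCompletion L)) :
          Matrix (Fin N) (Fin N) (w.1.adicCompletion L)) - 1)) ∈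
      Algebra.adjoin 𝒪[w.1.adicCompletion L] ({(((localNonsplitEquiv (IsCMField.complexConj L) H hc w hw u :
        ↥(unitaryGroupOfForm (galAdicCompletionMap (L := L) (IsCMField.complexConj L) hw) (placeForm H w.1))) : GL (Fin N) (w.1.adicCompletion L)) :
          Matrix (Fin N) (Fin N) (w.1.adicCompletion L))} : Set (Matrix (Fin N) (Fin N) (w.1.adicCompletion L))))
    (g : (cmDatum L N H).Local v → ℂ) (hginv : ∀ k ∈ cmLocalIntegralLevel L N H v, ∀ x, g (k * x * k⁻¹) = g x)
    (hg2 : ∀ U : (cmDatum L N H).Local v, IsIntMatrix ((ϖ ^ 2)⁻¹ • ((((localNonsplitEquiv (IsCMField.complexConj L) H hc w hw U :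
        ↥(unitaryGroupOfForm (galAdicCompletionMap (L := L) (IsCMField.complexConj L) hw) (placeForm H w.1))) : GL (Fin N) (w.1.adicCompletion L)) :
          Matrix (Fin N) (Fin N) (w.1.adicCompletion L)) - 1)) → ∀ x, g (U * x) = g x) :
    ∃ g' : (cmDatum L N H).Local v → ℂ,
      Literature.NumberTheory.Rogawski1990.IsLocSmooth g' ∧ tsupport g' ⊆ (cmLocalIntegralLevel L N H v : Set ((cmDatum L N H).Local v)) ∧
      (∀ k ∈ cmLocalIntegralLevel L N H v, ∀ x, g' (k * x * k⁻¹) = g' x) ∧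
      (∀ U : (cmDatum L N H).Local v, IsIntMatrix ((ϖ ^ 1)⁻¹ • ((((localNonsplitEquiv (IsCMField.complexConj L) H hc w hw U :
        ↥(unitaryGroupOfForm (galAdicCompletionMap (L := L) (IsCMField.complexConj L) hw) (placeForm H w.1))) : GL (Fin N) (w.1.adicCompletion L)) :
          Matrix (Fin N) (Fin N) (w.1.adicCompletion L)) - 1)) → ∀ x, g' (U * x) = g' x) ∧
      (∀ x ∈ cmLocalIntegralLevel L N H v, ∀ k₂ ∈ cmLocalIntegralLevel L N H v,
        IsIntMatrix ((ϖ ^ 2)⁻¹ • (aeval (((localNonsplitEquiv (IsCMField.complexConj L) H hc w hw x :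
        ↥(unitaryGroupOfForm (galAdicCompletionMap (L := L) (IsCMField.complexConj L) hw) (placeForm H w.1))) : GL (Fin N) (w.1.adicCompletion L)) :
          Matrix (Fin N) (Fin N) (w.1.adicCompletion L)) (1 + C (⟨ϖ, hϖi⟩ : 𝒪[w.1.adicCompletion L]) * (q - 1)) -
      (((localNonsplitEquiv (IsCMField.complexConj L) H hc w hw k₂ :
        ↥(unitaryGroupOfForm (galAdicCompletionMap (L := L) (IsCMField.complexConj L) hw) (placeForm H w.1))) : GL (Fin N) (w.1.adicCompletion L)) :
          Matrix (Fin N) (Fin N) (w.1.adicCompletion L)))) → g' x = g k₂) ∧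
      (∀ g₀ : (cmDatum L N H).Local v, g₀⁻¹ * u * g₀ ∈ cmLocalIntegralLevel L N H v → g' (g₀⁻¹ * u * g₀) = g (g₀⁻¹ * γ * g₀)) := by
  classical
  -- integrality on `K`
  have hKi : ∀ x ∈ cmLocalIntegralLevel L N H v, IsIntMatrix (((localNonsplitEquiv (IsCMField.complexConj L) H hc w hw x :
        ↥(unitaryGroupOfForm (galAdicCompletionMap (L := L) (IsCMField.complexConj L) hw) (placeForm H w.1))) : GL (Fin N) (w.1.adicCompletion L)) :
          Matrix (Fin N) (Fin N) (w.1.adicCompletion L)) := fun x hx =>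
    ((mem_cmLocalIntegralLevel_iff_isIntMatrix L N H hc w hw x).1 hx).1
  have hKi' : ∀ x ∈ cmLocalIntegralLevel L N H v, IsIntMatrix ((((localNonsplitEquiv (IsCMField.complexConj L) H hc w hw x :
        ↥(unitaryGroupOfForm (galAdicCompletionMap (L := L) (IsCMField.complexConj L) hw) (placeForm H w.1))) : GL (Fin N) (w.1.adicCompletion L))⁻¹ : GL (Fin N) (w.1.adicCompletion L)) : Matrix (Fin N) (Fin N) (w.1.adicCompletion L)) := fun x hx =>
    ((mem_cmLocalIntegralLevel_iff_isIntMatrix L N H hc w hw x).1 hx).2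
  -- the admissibility predicate `P` and the piece `g′`, kept opaque behind defining equations
  obtain ⟨P, hPdef⟩ : ∃ P : (cmDatum L N H).Local v → Prop, ∀ x, P x ↔ (x ∈ cmLocalIntegralLevel L N H v ∧ ∃ k₂ : (cmDatum L N H).Local v, k₂ ∈ cmLocalIntegralLevel L N H v ∧
      IsIntMatrix ((ϖ ^ 2)⁻¹ • (aeval (((localNonsplitEquiv (IsCMField.complexConj L) H hc w hw x :
        ↥(unitaryGroupOfForm (galAdicCompletionMap (L := L) (IsCMField.complexConj L) hw) (placeForm H w.1))) : GL (Fin N) (w.1.adicCompletion L)) :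
          Matrix (Fin N) (Fin N) (w.1.adicCompletion L)) (1 + C (⟨ϖ, hϖi⟩ : 𝒪[w.1.adicCompletion L]) * (q - 1)) -
      (((localNonsplitEquiv (IsCMField.complexConj L) H hc w hw k₂ :
        ↥(unitaryGroupOfForm (galAdicCompletionMap (L := L) (IsCMField.complexConj L) hw) (placeForm H w.1))) : GL (Fin N) (w.1.adicCompletion L)) :
          Matrix (Fin N) (Fin N) (w.1.adicCompletion L))))) := ⟨_, fun _ => Iff.rfl⟩
  obtain ⟨g', hg'def⟩ : ∃ g' : (cmDatum L N H).Local v → ℂ, ∀ x, g' x = if h : P x then g (Classical.choose ((hPdef x).1 h).2) else 0 := ⟨_, fun _ => rfl⟩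
  -- THE VALUE FORMULA (well-definedness by the level gain)
  have hval : ∀ x ∈ cmLocalIntegralLevel L N H v, ∀ k₂ ∈ cmLocalIntegralLevel L N H v,
      IsIntMatrix ((ϖ ^ 2)⁻¹ • (aeval (((localNonsplitEquiv (IsCMField.complexConj L) H hc w hw x :
        ↥(unitaryGroupOfForm (galAdicCompletionMap (L := L) (IsCMField.complexConj L) hw) (placeForm H w.1))) : GL (Fin N) (w.1.adicCompletion L)) :
          Matrix (Fin N) (Fin N) (w.1.adicCompletion L)) (1 + C (⟨ϖ, hϖi⟩ : 𝒪[w.1.adicCompletion L]) * (q - 1)) -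
      (((localNonsplitEquiv (IsCMField.complexConj L) H hc w hw k₂ :
        ↥(unitaryGroupOfForm (galAdicCompletionMap (L := L) (IsCMField.complexConj L) hw) (placeForm H w.1))) : GL (Fin N) (w.1.adicCompletion L)) :
          Matrix (Fin N) (Fin N) (w.1.adicCompletion L)))) → g' x = g k₂ := by
    intro x hx k₂ hk₂ hadm
    have hP : P x := (hPdef x).2 ⟨hx, k₂, hk₂, hadm⟩
    rw [hg'def x, dif_pos hP]
    obtain ⟨hk₃, hadm₃⟩ := Classical.choose_spec ((hPdef x).1 hP).2
    exact apply_eq_of_congr_levelTwo L N H hc w hw g hg2 _ k₂ hk₂ (isIntMatrix_inv_smul_sub_of_sub_of_sub _ hadm₃ hadm)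
  have hzero : ∀ x, ¬ P x → g' x = 0 := fun x hx => by rw [hg'def x, dif_neg hx]
  have hadmU := relabel_congr_of_level_mul L N H hc w hw hϖ0 hϖ1 hϖi q
  have hadmK := relabel_congr_of_conj L N H hc w hw hϖi q
  -- `P` is stable under level-1 translations and `K`-conjugation
  have hPU : ∀ U : (cmDatum L N H).Local v, IsIntMatrix ((ϖ ^ 1)⁻¹ • ((((localNonsplitEquiv (IsCMField.complexConj L) H hc w hw U :
        ↥(unitaryGroupOfForm (galAdicCompletionMap (L := L) (IsCMField.complexConj L) hw) (placeForm H w.1))) : GL (Fin N) (w.1.adicCompletion L)) :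
          Matrix (Fin N) (Fin N) (w.1.adicCompletion L)) - 1)) → ∀ x, P x → P (U * x) := by
    intro U hU x hP
    obtain ⟨hx, k₂, hk₂, hadm⟩ := (hPdef x).1 hP
    exact (hPdef _).2 ⟨mul_mem (mem_cmLocalIntegralLevel_of_level L N H hc w hw hϖ0 hϖ1 le_rfl U hU) hx, k₂, hk₂, hadmU U hU x hx k₂ hadm⟩
  have hPK : ∀ k ∈ cmLocalIntegralLevel L N H v, ∀ x, P x → P (k * x * k⁻¹) := by
    intro k hk x hP
    obtain ⟨hx, k₂, hk₂, hadm⟩ := (hPdef x).1 hP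
    exact (hPdef _).2 ⟨mul_mem (mul_mem hk hx) (inv_mem hk), k * k₂ * k⁻¹, mul_mem (mul_mem hk hk₂) (inv_mem hk), hadmK k hk x k₂ hadm⟩
  -- level-1 invariance
  have hlvl : ∀ U : (cmDatum L N H).Local v, IsIntMatrix ((ϖ ^ 1)⁻¹ • ((((localNonsplitEquiv (IsCMField.complexConj L) H hc w hw U :
        ↥(unitaryGroupOfForm (galAdicCompletionMap (L := L) (IsCMField.complexConj L) hw) (placeForm H w.1))) : GL (Fin N) (w.1.adicCompletion L)) :
          Matrix (Fin N) (Fin N) (w.1.adicCompletion L)) - 1)) → ∀ x, g' (U * x) = g' x := by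
    intro U hU x
    have hUK := mem_cmLocalIntegralLevel_of_level L N H hc w hw hϖ0 hϖ1 le_rfl U hU
    by_cases hP : P x
    · obtain ⟨hx, k₂, hk₂, hadm⟩ := (hPdef x).1 hP
      rw [hval x hx k₂ hk₂ hadm, hval (U * x) (mul_mem hUK hx) k₂ hk₂ (hadmU U hU x hx k₂ hadm)]
    · have hP' : ¬ P (U * x) := by
        intro h
        apply hP
        have hU' := level_inv_of_level L N H hc w hw hϖ0 hϖ1 le_rfl U hU
        have h2 := hPU U⁻¹ hU' (U * x) h
        rwa [inv_mul_cancel_left] at h2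
      rw [hzero _ hP', hzero _ hP]
  -- support
  have hsupp : Function.support g' ⊆ (cmLocalIntegralLevel L N H v : Set ((cmDatum L N H).Local v)) := by
    intro x hx
    by_contra hxK
    exact hx (hzero x fun h => hxK ((hPdef x).1 h).1)
  obtain ⟨hls, hts⟩ := isLocSmooth_of_level_invariant_of_support_subset L N H hc w hw hϖ0 1 g' hlvl hsupp
  refine ⟨g', hls, hts, ?_, hlvl, hval, ?_⟩
  · -- Ad(`K`)-invariance
    intro k hk x
    by_cases hP : P x
    · obtain ⟨hx, k₂, hk₂, hadm⟩ := (hPdef x).1 hP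
      rw [hval x hx k₂ hk₂ hadm, hval (k * x * k⁻¹) (mul_mem (mul_mem hk hx) (inv_mem hk)) (k * k₂ * k⁻¹) (mul_mem (mul_mem hk hk₂) (inv_mem hk))
        (hadmK k hk x k₂ hadm), hginv k hk k₂]
    · have hP' : ¬ P (k * x * k⁻¹) := by
        intro h
        apply hP
        have h2 := hPK k⁻¹ (inv_mem hk) _ h
        rwa [inv_inv, ← mul_assoc, ← mul_assoc, inv_mul_cancel, one_mul, mul_assoc, inv_mul_cancel, mul_one] at h2
      rw [hzero _ hP', hzero _ hP]
  · -- the shift-conjugates: `g′(g₀⁻¹ u g₀) = g(g₀⁻¹ γ g₀)`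
    intro g₀ hg₀
    have hγK := ((conj_mem_and_interior_iff_conj_mem L N H hc w hw hϖ0 hϖ1 γ u hu hu' hX g₀).1 hg₀).1
    refine hval _ hg₀ _ hγK ?_
    rw [← coe_localNonsplitEquiv_conj_eq_aeval_relabel L N H hc w hw hϖ0 hϖi γ u q hq g₀, sub_self, smul_zero]
    exact isIntMatrix_zero

end Place

end Literature.NumberTheory.Automorphic

end
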